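import Summits.Langlands.Langlands.Theorems.RationalPeriodQuarterAnalyticCoreDelta

/-!
# `AnalyticCore` (child 2 of the lens-1-g38 split of `RationalPeriodQuarter.SemiAnalyticRigidity`) — one global fraction

LEMMA ONEFRAC.  A function `k : ℝ → ℂ` that is TAME at every real point (analytic germ + fraction on a punctured
neighbourhood) and is cofinitely a fraction on the right tail and (possibly another) fraction on the left tail is
cofinitely ONE fraction `A/B` (no common root) on all of `ℝ`, and equals it on a punctured neighbourhood of every
point.  Proof: the set of points near which `k = A/B` is open, closed (tameness + rigidity of rational identities
for the analytic germ) and nonempty, hence all of `ℝ`; cofiniteness from local finiteness on a compact middle and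
the two tails.  Applied downstream to `k = Δ(f - ρ)`.
-/

set_option linter.dupNamespace false

namespace Summit.Langlands.Langlands.Theorems

open Filter Set Topology Polynomial

/-- A cofinite statement restricted to an open half-line holds on a full neighbourhood of some point of it
(right version). -/
theorem anCore_exists_nhds_right {p : ℝ → Prop} (R : ℝ) (h : ∀ᶠ t in Filter.cofinite, R < t → p t) :
    ∃ y : ℝ, R < y ∧ ∀ᶠ (t : ℝ) in 𝓝 y, p t := by
  rw [Filter.eventually_cofinite] at h
  set X := {t : ℝ | ¬(R < t → p t)} with hX
  have hU : IsOpen (Set.Ioi R \ X) := isOpen_Ioi.sdiff h.isClosed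
  have hne : (Set.Ioi R \ X).Nonempty := by
    by_contra hc
    rw [Set.not_nonempty_iff_eq_empty, Set.sdiff_eq_empty] at hc
    exact (Set.Ioi_infinite R) (h.subset hc)
  obtain ⟨y, hy⟩ := hne
  refine ⟨y, hy.1, ?_⟩
  filter_upwards [hU.mem_nhds hy] with t ht
  have := ht.2
  simp only [hX, Set.mem_setOf_eq, not_not] at this
  exact this ht.1

/-- Left version. -/
theorem anCore_exists_nhds_left {p : ℝ → Prop} (R : ℝ) (h : ∀ᶠ t in Filter.cofinite, t < -R → p t) :
    ∃ y : ℝ, y < -R ∧ ∀ᶠ (t : ℝ) in 𝓝 y, p t := by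
  rw [Filter.eventually_cofinite] at h
  set X := {t : ℝ | ¬(t < -R → p t)} with hX
  have hU : IsOpen (Set.Iio (-R) \ X) := isOpen_Iio.sdiff h.isClosed
  have hne : (Set.Iio (-R) \ X).Nonempty := by
    by_contra hc
    rw [Set.not_nonempty_iff_eq_empty, Set.sdiff_eq_empty] at hc
    exact (Set.Iio_infinite (-R)) (h.subset hc)
  obtain ⟨y, hy⟩ := hne
  refine ⟨y, hy.1, ?_⟩
  filter_upwards [hU.mem_nhds hy] with t ht
  have := ht.2
  simp only [hX, Set.mem_setOf_eq, not_not] at this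
  exact this ht.1

/-- The closedness step: if `k` is tame at `x` and `k = A/B` punctured-near points arbitrarily close to `x`, then
`k = A/B` punctured-near `x`. -/
theorem anCore_onefrac_closed (k : ℝ → ℂ) (x : ℝ)
    (htame : ∃ g : ℝ → ℂ, AnalyticAt ℝ g x ∧ ∃ P Q : ℂ[X], Q ≠ 0 ∧
      ∀ᶠ (t : ℝ) in 𝓝[≠] x, k t = g t + P.eval (t : ℂ) / Q.eval (t : ℂ))
    (A B : ℂ[X]) (hB : B ≠ 0)
    (hcl : x ∈ closure {y : ℝ | ∀ᶠ (t : ℝ) in 𝓝[≠] y, B.eval (t : ℂ) ≠ 0 ∧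
      k t = A.eval (t : ℂ) / B.eval (t : ℂ)}) :
    ∀ᶠ (t : ℝ) in 𝓝[≠] x, B.eval (t : ℂ) ≠ 0 ∧ k t = A.eval (t : ℂ) / B.eval (t : ℂ) := by
  obtain ⟨g, hg, P, Q, hQ, hk⟩ := htame
  have hBev := tameDecomp_eventually_nhdsNE_of_cofinite (tameDecomp_eventually_cofinite_eval_ne_zero hB) x
  have hQev := tameDecomp_eventually_nhdsNE_of_cofinite (tameDecomp_eventually_cofinite_eval_ne_zero hQ) x
  -- a ball on which `g` is analytic and `k = g + P/Q` off the centre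
  have hgev := hg.eventually_analyticAt
  obtain ⟨ε, hε, hball⟩ := Metric.eventually_nhds_iff.1 (hgev.and (eventually_nhdsWithin_iff.1 hk))
  -- a point of the set inside the half-ball
  obtain ⟨y, hyS, hyx⟩ := Metric.mem_closure_iff.1 hcl (ε / 2) (by linarith)
  by_cases hyeq : y = x
  · rw [hyeq] at hyS; exact hyS
  -- near `y`: `g = A/B - P/Q`, reduced to a fraction without common root
  obtain ⟨A', B', hB', hno', hred⟩ := anCore_reduce (A * Q - P * B) (B * Q) (mul_ne_zero hB hQ)
  have hyQ := tameDecomp_eventually_nhdsNE_of_cofinite (tameDecomp_eventually_cofinite_eval_ne_zero hQ) y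
  have hynear : ∀ᶠ (t : ℝ) in 𝓝 y, t ≠ x ∧ dist t x < ε := by
    have h1 : ∀ᶠ (t : ℝ) in 𝓝 y, t ≠ x := isOpen_ne.mem_nhds hyeq
    have h2 : ∀ᶠ (t : ℝ) in 𝓝 y, dist t x < ε := by
      have : ∀ᶠ (t : ℝ) in 𝓝 y, dist t y < ε / 2 := Metric.ball_mem_nhds y (by linarith)
      filter_upwards [this] with t ht
      have hyx' : dist y x < ε / 2 := by rwa [dist_comm] at hyx
      calc dist t x ≤ dist t y + dist y x := dist_triangle _ _ _
        _ < ε / 2 + ε / 2 := add_lt_add ht hyx'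
        _ = ε := by ring
    exact h1.and h2
  have hyall : ∀ᶠ (t : ℝ) in 𝓝[≠] y, dist t x < ε ∧ B'.eval (t : ℂ) ≠ 0 ∧
      g t = A'.eval (t : ℂ) / B'.eval (t : ℂ) ∧ B.eval (t : ℂ) ≠ 0 ∧ Q.eval (t : ℂ) ≠ 0 ∧
      A.eval (t : ℂ) / B.eval (t : ℂ) = g t + P.eval (t : ℂ) / Q.eval (t : ℂ) := by
    filter_upwards [hyS, hyQ, mem_nhdsWithin_of_mem_nhds hynear] with t ht hq hn
    have hkt := (hball hn.2).2 hn.1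
    have hBQ : (B * Q).eval (t : ℂ) ≠ 0 := by
      rw [Polynomial.eval_mul]; exact mul_ne_zero ht.1 hq
    obtain ⟨hB't, hfr⟩ := hred (t : ℂ) hBQ
    have hgt : g t = A.eval (t : ℂ) / B.eval (t : ℂ) - P.eval (t : ℂ) / Q.eval (t : ℂ) := by
      rw [← ht.2, hkt]; ring
    refine ⟨hn.2, hB't, ?_, ht.1, hq, by rw [← ht.2, hkt]⟩
    have hBt := ht.1
    rw [hgt, ← hfr, Polynomial.eval_sub, Polynomial.eval_mul, Polynomial.eval_mul, Polynomial.eval_mul]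
    field_simp
  obtain ⟨y', -, -, hy'⟩ := anCore_exists_nhds_of_nhdsNE hyall one_pos
  have hy'self := hy'.self_of_nhds
  -- rigidity on the ball: `g = A'/B'` on the whole ball
  have hrig := anCore_rigid g (Metric.ball x ε) (convex_ball x ε).isPreconnected
    (fun z hz => (hball (Metric.mem_ball.1 hz)).1) A' B' hno' y' (Metric.mem_ball.2 hy'self.1)
    (hy'.mono fun t ht => ⟨ht.2.1, ht.2.2.1⟩)
  -- the polynomial identity `(A' Q + P B') B = A (B' Q)` from agreement near `y'`
  have hcross := anCore_cross_eq_of_eventually (A' * Q + P * B') (B' * Q) A B y' (by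
    filter_upwards [hy'] with t ht
    obtain ⟨-, hB't, hgt, hBt, hQt, hABt⟩ := ht
    refine ⟨by rw [Polynomial.eval_mul]; exact mul_ne_zero hB't hQt, hBt, ?_⟩
    rw [hABt, hgt, Polynomial.eval_add, Polynomial.eval_mul, Polynomial.eval_mul, Polynomial.eval_mul]
    field_simp)
  -- conclude on the punctured ball minus the zeros of `B`, `Q`
  have hxball : ∀ᶠ (t : ℝ) in 𝓝[≠] x, t ≠ x ∧ dist t x < ε := by
    rw [eventually_nhdsWithin_iff]
    filter_upwards [Metric.ball_mem_nhds x hε] with t ht hne using ⟨hne, ht⟩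
  filter_upwards [hxball, hBev, hQev] with t ht hBt hQt
  have hkt := (hball ht.2).2 ht.1
  obtain ⟨hB't, hgt⟩ := hrig t (Metric.mem_ball.2 ht.2)
  refine ⟨hBt, ?_⟩
  rw [hkt, hgt]
  have := congrArg (Polynomial.eval (t : ℂ)) hcross
  simp only [Polynomial.eval_mul, Polynomial.eval_add] at this
  field_simp
  linear_combination this

/-- LEMMA ONEFRAC (see the module docstring). -/
theorem anCore_onefrac (k : ℝ → ℂ)
    (htame : ∀ x : ℝ, ∃ g : ℝ → ℂ, AnalyticAt ℝ g x ∧ ∃ P Q : ℂ[X], Q ≠ 0 ∧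
      ∀ᶠ (t : ℝ) in 𝓝[≠] x, k t = g t + P.eval (t : ℂ) / Q.eval (t : ℂ))
    (A₀ B₀ : ℂ[X]) (hB₀ : B₀ ≠ 0) (R₀ : ℝ) (hB₀R : ∀ t : ℝ, R₀ < t → B₀.eval (t : ℂ) ≠ 0)
    (hk₀ : ∀ᶠ t in Filter.cofinite, R₀ < t → k t = A₀.eval (t : ℂ) / B₀.eval (t : ℂ))
    (A₁ B₁ : ℂ[X]) (R₁ : ℝ) (hB₁R : ∀ t : ℝ, t < -R₁ → B₁.eval (t : ℂ) ≠ 0)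
    (hk₁ : ∀ᶠ t in Filter.cofinite, t < -R₁ → k t = A₁.eval (t : ℂ) / B₁.eval (t : ℂ)) :
    ∃ A B : ℂ[X], B ≠ 0 ∧ (∀ β : ℂ, ¬ (A.IsRoot β ∧ B.IsRoot β)) ∧
      (∀ x : ℝ, ∀ᶠ (t : ℝ) in 𝓝[≠] x, B.eval (t : ℂ) ≠ 0 ∧ k t = A.eval (t : ℂ) / B.eval (t : ℂ)) ∧
      ∀ᶠ (t : ℝ) in Filter.cofinite, B.eval (t : ℂ) ≠ 0 ∧ k t = A.eval (t : ℂ) / B.eval (t : ℂ) := by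
  obtain ⟨A, B, hB, hno, hred⟩ := anCore_reduce A₀ B₀ hB₀
  set S : Set ℝ := {y : ℝ | ∀ᶠ (t : ℝ) in 𝓝[≠] y, B.eval (t : ℂ) ≠ 0 ∧
    k t = A.eval (t : ℂ) / B.eval (t : ℂ)} with hS
  -- S is open
  have hopen : IsOpen S := by
    rw [isOpen_iff_mem_nhds]
    intro x hx
    have hx' := (eventually_nhdsWithin_iff.1 hx).eventually_nhds
    filter_upwards [hx'] with y hy
    by_cases hyx : y = x
    · rw [hyx]; exact hx
    · have hne : ∀ᶠ (t : ℝ) in 𝓝 y, t ≠ x := isOpen_ne.mem_nhds hyx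
      exact mem_nhdsWithin_of_mem_nhds ((hy.and hne).mono fun t ht => ht.1 ht.2)
  -- S is closed
  have hclosed : IsClosed S := by
    rw [← closure_subset_iff_isClosed]
    intro x hx
    exact anCore_onefrac_closed k x (htame x) A B hB hx
  -- S is nonempty (a point of the right tail)
  have hnonempty : S.Nonempty := by
    obtain ⟨y, hy, hynhds⟩ := anCore_exists_nhds_right (p := fun t : ℝ => R₀ < t ∧
      k t = A₀.eval (t : ℂ) / B₀.eval (t : ℂ)) R₀ (hk₀.mono fun t ht hR => ⟨hR, ht hR⟩)
    refine ⟨y, mem_nhdsWithin_of_mem_nhds ?_⟩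
    filter_upwards [hynhds] with t ht
    obtain ⟨hBt, heq⟩ := hred (t : ℂ) (hB₀R t ht.1)
    exact ⟨hBt, by rw [ht.2, heq]⟩
  have hS_univ : S = Set.univ := IsClopen.eq_univ ⟨hclosed, hopen⟩ hnonempty
  have hloc : ∀ x : ℝ, ∀ᶠ (t : ℝ) in 𝓝[≠] x, B.eval (t : ℂ) ≠ 0 ∧
      k t = A.eval (t : ℂ) / B.eval (t : ℂ) := by
    intro x
    have : x ∈ S := by rw [hS_univ]; exact Set.mem_univ x
    exact this
  refine ⟨A, B, hB, hno, hloc, ?_⟩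
  -- the left tail fraction agrees with `A/B`
  have hcross : A * B₁ = A₁ * B := by
    obtain ⟨y, hy, hynhds⟩ := anCore_exists_nhds_left (p := fun t : ℝ => t < -R₁ ∧
      k t = A₁.eval (t : ℂ) / B₁.eval (t : ℂ)) R₁ (hk₁.mono fun t ht hR => ⟨hR, ht hR⟩)
    have hall : ∀ᶠ (t : ℝ) in 𝓝[≠] y, B.eval (t : ℂ) ≠ 0 ∧ B₁.eval (t : ℂ) ≠ 0 ∧
        A.eval (t : ℂ) / B.eval (t : ℂ) = A₁.eval (t : ℂ) / B₁.eval (t : ℂ) := by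
      filter_upwards [hloc y, mem_nhdsWithin_of_mem_nhds hynhds] with t ht ht'
      exact ⟨ht.1, hB₁R t ht'.1, by rw [← ht.2, ht'.2]⟩
    obtain ⟨y', -, -, hy'⟩ := anCore_exists_nhds_of_nhdsNE hall one_pos
    exact anCore_cross_eq_of_eventually A B A₁ B₁ y' hy'
  have hBcof := tameDecomp_eventually_cofinite_eval_ne_zero (Q := B) hB
  have htail : ∀ᶠ t in Filter.cofinite, (max R₀ R₁ < t ∨ t < -max R₀ R₁) →
      k t = A.eval (t : ℂ) / B.eval (t : ℂ) := by
    filter_upwards [hk₀, hk₁, hBcof] with t h0 h1 hBt hR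
    rcases hR with hR | hR
    · have hR0 : R₀ < t := lt_of_le_of_lt (le_max_left _ _) hR
      obtain ⟨-, heq⟩ := hred (t : ℂ) (hB₀R t hR0)
      rw [h0 hR0, heq]
    · have hR1 : t < -R₁ := by linarith [le_max_right R₀ R₁]
      have hB₁t := hB₁R t hR1
      rw [h1 hR1, div_eq_div_iff hB₁t hBt]
      have := congrArg (Polynomial.eval (t : ℂ)) hcross
      simp only [Polynomial.eval_mul] at this
      linear_combination -this
  have hcof := anCore_cofinite_of_local k (fun t => A.eval (t : ℂ) / B.eval (t : ℂ)) (max R₀ R₁)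
    (fun x => (hloc x).mono fun t ht => ht.2) htail
  exact (hBcof.and hcof)

end Summit.Langlands.Langlands.Theorems
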